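import Literature.AnabelianGeometry.AbsoluteAnabelian.GaloisTheatersNumberFieldShadow
import Mathlib.Analysis.AbsoluteValue.Equivalence
import Mathlib.Analysis.SpecificLimits.Normed
import HarnessLib

/-!
# [AbsTopIII] Rmk 5.1.1 (arc) at the number-field shadow: archimedean local elements are separated by the
# topologies their embeddings `κ_v : F̄ ↪ ℂ` induce on `F̄`

S. Mochizuki, *Topics in absolute anabelian geometry III* [MochizukiAbsTopIII2015], Rmk 5.1.1 p. 118: "for
archimedean elements, [uniqueness follows] by considering the topology induced on `k_NF(Π_X)` by `A_{X_v}` via `κ_v`".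

PROOF-ONLY companion (0 `def`s, 0 `Prop` facts, no `instance`/`notation`) — abc-iut-w6-d038 (gen 3), the `harc`
half matching `NumberFieldValuationProSetNonArchRigidityProofs.lean` (the `hnon` half).  The cell's
`GaloisTheatersRmk511.referenceIsoUnique_of_separated` / `theaterHomDeterminedByGroupHom_of_separated`
(abc-iut-L4-t3 lineage) take the binder

  `harc : ∀ v w : (R.proVal E).arc, induced (R.κell E v) (R.archSpace E v).topA =
            induced (R.κell E w) (R.archSpace E w).topA → v = w`.

Here it is PROVED at abc-iut-L4-d2's number-field shadow data (`GaloisTheatersNumberFieldShadow.lean`: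
`shadowProVal F E` = the genuine `V⊚(F̄/F)` pulled back along `E.arith ≅ G_F`, `shadowKappa F E v` = Mathlib's complex
embedding of the infinite place of `F̄` under `v`, `A_X := ℂ`):

* `norm_lt_one_iff_tendsto_pow_induced` — for ANY ring embedding `φ : K →+* ℂ`: `‖φ x‖ < 1 ↔ xⁿ → 0` in the topology
  `φ` induces on `K` (so the open unit ball of the place of `φ` is read off the induced topology);
* `infinitePlace_mk_eq_mk_iff_induced_eq` — two complex embeddings of a field of characteristic `0` define the SAME
  infinite place iff they induce the same topology (⇒: conjugate embeddings; ⇐: same unit balls ⇒ equivalent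
  absolute values (Mathlib `AbsoluteValue.isEquiv_iff_lt_one_iff`) ⇒ equal, both being `|·|` on `ℚ`);
  `infinitePlace_eq_of_induced_embedding_eq`;
* `NumberFieldValuationProSet.arch_eq_of_induced_embedding_eq` (genuine pro-set) and
  **`NumberFieldShadow.arc_eq_of_induced_shadowKappa_eq`** / **`induced_shadowKappa_separates_arc`** — the `harc`
  binder, verbatim shape, at the shadow.

Classical (Ostrowski-type normalisation); nothing here bears on [IUTchIII] Cor. 3.12 or takes a side.
-/

noncomputable section

open Filter Topology NumberField

namespace Literature.AnabelianGeometry.AbsoluteAnabelian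

/-! ### Complex embeddings: the unit ball of the place is visible in the induced topology -/

section Embeddings

variable {K : Type*} [Field K]

/-- For a ring embedding `φ : K →+* ℂ` and `x ∈ K`: `‖φ x‖ < 1` iff `xⁿ → 0` for the topology `φ` induces on `K`.
[cite: MochizukiAbsTopIII2015, Rmk 5.1.1 p.118] -/
theorem norm_lt_one_iff_tendsto_pow_induced (φ : K →+* ℂ) (x : K) :
    ‖φ x‖ < 1 ↔ Tendsto (fun n : ℕ => x ^ n) atTop
      (@nhds K (TopologicalSpace.induced φ (inferInstance : TopologicalSpace ℂ)) 0) := by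
  letI : TopologicalSpace K := TopologicalSpace.induced φ (inferInstance : TopologicalSpace ℂ)
  have hφ : IsInducing φ := ⟨rfl⟩
  rw [hφ.tendsto_nhds_iff, map_zero]
  have hcomp : (φ ∘ fun n : ℕ => x ^ n) = fun n : ℕ => (φ x) ^ n := by
    funext n
    simp only [Function.comp_apply, map_pow]
  rw [hcomp, tendsto_pow_atTop_nhds_zero_iff_norm_lt_one]

/-- Two complex embeddings inducing the same topology on `K` have the same open unit ball.
[cite: MochizukiAbsTopIII2015, Rmk 5.1.1 p.118] -/
theorem norm_lt_one_iff_of_induced_eq {φ ψ : K →+* ℂ}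
    (h : TopologicalSpace.induced φ (inferInstance : TopologicalSpace ℂ) =
      TopologicalSpace.induced ψ (inferInstance : TopologicalSpace ℂ)) (x : K) :
    ‖φ x‖ < 1 ↔ ‖ψ x‖ < 1 := by
  rw [norm_lt_one_iff_tendsto_pow_induced φ x, norm_lt_one_iff_tendsto_pow_induced ψ x, h]

/-- An infinite place takes the value `|q|` at a rational number `q`. [cite: MochizukiAbsTopIII2015, Rmk 5.1.1 p.118] -/
theorem infinitePlace_apply_ratCast [CharZero K] (w : InfinitePlace K) (q : ℚ) : w (q : K) = |(q : ℝ)| := by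
  rw [← InfinitePlace.norm_embedding_eq, map_ratCast, Complex.norm_ratCast]

/-- Infinite places whose absolute values are EQUIVALENT (same order) are EQUAL: both restrict to `|·|` on `ℚ`,
and a real number is determined by the rationals above it. [cite: MochizukiAbsTopIII2015, Rmk 5.1.1 p.118] -/
theorem infinitePlace_eq_of_isEquiv [CharZero K] {w w' : InfinitePlace K} (h : w.1.IsEquiv w'.1) : w = w' := by
  refine DFunLike.ext w w' fun x => eq_of_forall_lt_rat_iff_lt fun q => ?_
  rcases le_or_gt (q : ℝ) 0 with hq0 | hq0
  · have h0 : ∀ v : InfinitePlace K, ¬ v x < q := fun v hlt => not_lt.2 (v.1.nonneg x) (hlt.trans_le hq0)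
    exact ⟨fun hlt => absurd hlt (h0 w), fun hlt => absurd hlt (h0 w')⟩
  · calc w x < q ↔ w x < w (q : K) := by rw [infinitePlace_apply_ratCast, abs_of_pos hq0]
      _ ↔ w' x < w' (q : K) := h.lt_iff_lt
      _ ↔ w' x < q := by rw [infinitePlace_apply_ratCast, abs_of_pos hq0]

/-- **Two complex embeddings of a field of characteristic `0` inducing the same topology define the same infinite
place.** [cite: MochizukiAbsTopIII2015, Rmk 5.1.1 p.118] -/
theorem infinitePlace_mk_eq_mk_of_induced_eq [CharZero K] {φ ψ : K →+* ℂ}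
    (h : TopologicalSpace.induced φ (inferInstance : TopologicalSpace ℂ) =
      TopologicalSpace.induced ψ (inferInstance : TopologicalSpace ℂ)) :
    InfinitePlace.mk φ = InfinitePlace.mk ψ := by
  refine infinitePlace_eq_of_isEquiv (AbsoluteValue.isEquiv_iff_lt_one_iff.2 fun x => ?_)
  have hx := norm_lt_one_iff_of_induced_eq h x
  rwa [← InfinitePlace.apply φ x, ← InfinitePlace.apply ψ x] at hx

/-- Conversely, embeddings defining the same infinite place (equal or complex conjugate) induce the same topology.
[cite: MochizukiAbsTopIII2015, Rmk 5.1.1 p.118] -/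
theorem induced_eq_of_infinitePlace_mk_eq {φ ψ : K →+* ℂ} (h : InfinitePlace.mk φ = InfinitePlace.mk ψ) :
    TopologicalSpace.induced φ (inferInstance : TopologicalSpace ℂ) =
      TopologicalSpace.induced ψ (inferInstance : TopologicalSpace ℂ) := by
  rcases InfinitePlace.mk_eq_iff.mp h with rfl | rfl
  · rfl
  · have hc : (⇑(ComplexEmbedding.conjugate φ) : K → ℂ) = Complex.conjCLE ∘ φ := by
      funext x
      exact ComplexEmbedding.conjugate_coe_eq φ x
    have hind : TopologicalSpace.induced (Complex.conjCLE : ℂ → ℂ) (inferInstance : TopologicalSpace ℂ) =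
        (inferInstance : TopologicalSpace ℂ) :=
      Complex.conjCLE.toHomeomorph.induced_eq
    rw [hc, ← induced_compose, hind]

/-- Two complex embeddings of a field of characteristic `0` define the same infinite place IFF they induce the same
topology on it. [cite: MochizukiAbsTopIII2015, Rmk 5.1.1 p.118] -/
theorem infinitePlace_mk_eq_mk_iff_induced_eq [CharZero K] {φ ψ : K →+* ℂ} :
    InfinitePlace.mk φ = InfinitePlace.mk ψ ↔
      TopologicalSpace.induced φ (inferInstance : TopologicalSpace ℂ) =
        TopologicalSpace.induced ψ (inferInstance : TopologicalSpace ℂ) :=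
  ⟨induced_eq_of_infinitePlace_mk_eq, infinitePlace_mk_eq_mk_of_induced_eq⟩

/-- Infinite places whose chosen embeddings induce the same topology are equal.
[cite: MochizukiAbsTopIII2015, Rmk 5.1.1 p.118] -/
theorem infinitePlace_eq_of_induced_embedding_eq [CharZero K] {w w' : InfinitePlace K}
    (h : TopologicalSpace.induced w.embedding (inferInstance : TopologicalSpace ℂ) =
      TopologicalSpace.induced w'.embedding (inferInstance : TopologicalSpace ℂ)) : w = w' := by
  rw [← InfinitePlace.mk_embedding w, ← InfinitePlace.mk_embedding w']
  exact infinitePlace_mk_eq_mk_of_induced_eq h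

end Embeddings

/-! ### At the genuine pro-set `V⊚(F̄/F)` and at the number-field shadow -/

namespace NumberFieldValuationProSet

variable (F : Type) [Field F] [CharZero F]

/-- (arc)-separation by induced topologies on the archimedean local elements of `V⊚(F̄/F)`: two infinite places of
`F̄` whose embeddings induce the same topology on `F̄` coincide. [cite: MochizukiAbsTopIII2015, Rmk 5.1.1 p.118] -/
theorem arch_eq_of_induced_embedding_eq {w w' : Arch F}
    (h : TopologicalSpace.induced w.embedding (inferInstance : TopologicalSpace ℂ) =
      TopologicalSpace.induced w'.embedding (inferInstance : TopologicalSpace ℂ)) : w = w' :=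
  infinitePlace_eq_of_induced_embedding_eq h

end NumberFieldValuationProSet

namespace NumberFieldShadow

variable (F : Type) [Field F] [NumberField F]

/-- **`harc` at the number-field shadow**: archimedean local elements `v, w` of `shadowProVal F E` whose embeddings
`κ_{ell,v}, κ_{ell,w} : F̄ ↪ A_X = ℂ` induce the same topology on `k_NF = F̄` are equal.
[cite: MochizukiAbsTopIII2015, Rmk 5.1.1 p.118] -/
theorem arc_eq_of_induced_shadowKappa_eq (E : FundamentalExtension.{0}) (v w : (shadowProVal F E).arc)
    (h : TopologicalSpace.induced (shadowKappa F E v) (shadowArchSpace F E v).topA =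
      TopologicalSpace.induced (shadowKappa F E w) (shadowArchSpace F E w).topA) : v = w := by
  have h' : TopologicalSpace.induced (arcPlace F E v).embedding (inferInstance : TopologicalSpace ℂ) =
      TopologicalSpace.induced (arcPlace F E w).embedding (inferInstance : TopologicalSpace ℂ) := h
  have e : arcPlace F E v = arcPlace F E w := infinitePlace_eq_of_induced_embedding_eq h'
  apply Subtype.ext
  rw [← inr_inr_arcPlace F E v, ← inr_inr_arcPlace F E w, e]

/-- **The `harc` binder of `referenceIsoUnique_of_separated` / `theaterHomDeterminedByGroupHom_of_separated`,
verbatim shape, at the number-field shadow**: the `κ_{ell,v}`-induced topologies on `k_NF` separate the archimedean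
local elements. [cite: MochizukiAbsTopIII2015, Rmk 5.1.1 p.118] -/
theorem induced_shadowKappa_separates_arc (E : FundamentalExtension.{0}) :
    ∀ v w : (shadowProVal F E).arc,
      TopologicalSpace.induced (shadowKappa F E v) (shadowArchSpace F E v).topA =
        TopologicalSpace.induced (shadowKappa F E w) (shadowArchSpace F E w).topA → v = w :=
  fun v w h => arc_eq_of_induced_shadowKappa_eq F E v w h

end NumberFieldShadow

end Literature.AnabelianGeometry.AbsoluteAnabelian

end
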